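import Summits.ABC.IUTFork.Repair.RHSharpUpperEdgeKill
import Summits.ABC.IUTFork.Cor312GenuineKLocalTypeThirty
import HarnessLib

/-!
# R-H ROUND 1 (D-0107), pair n = 10 — `RHSharpUpperEdgeKillSharp`: the SHARP edge's own bite in the theorem-grade kill of H⋆₁₀
# «sharp-upper-edge» — model-free thresholds `k ≥ 5` (`l = 11`) and `k ≥ 4` (`l = 13`) at the genuine `λ_k` datum

PROOF-ONLY file (0 definitions, 0 `Prop` facts) of the abc-iut cell, D-0079 RESCUE sub-cell R-H, rung LADDER-ABC:A2.RESCUE.H; seat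
abc-iut-rh-typ-10 gen 2 (R-H ROUND 1 PAIR n = 10 TYPER; row 10 of `plan/rescue/R-H/RH-CANDIDATES.tsv`; `ROUND1.tsv` row 10 = KILL(k1) FINAL,
evidence p458024 + p460832/p461283 + RH-K1-BATCH-v3). Companion of `RHSharpUpperEdgeKill` (p460832/p461283), split off for the 400-line rule.
TAKES NO SIDE on [IUTchIII] Cor. 3.12 or on any author; H⋆₁₀ is a claim-tagged HYPOTHESIS (p458024), never a Literature fact; «refuted as typed
at OUR genuine datum» ≠ «refuted in print»; typed ≠ proved; nothing here asserts abc.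

WHAT. `RHSharpUpperEdgeKill` §2–§3 kill H⋆₁₀ THROUGH PRINT's cell (`SharpCell ⟹` print cell `(l⋆²−1)·P ≤ e·(b_e+1)`, then abc-iut-rp-d2's
trigger of p456127), so its model-free thresholds are p456127's (`l = 11: k ≥ 6`, `l = 13: k ≥ 5`). Reading the H⋆₁₀ cell
`SharpCell 7 e P n :⟺ ∃ a, (n−1)·P + 7ᵃ ≤ (1 + a)·e` DIRECTLY at every `a` gains exactly one `k` at each `l`: with `P·l = k·e` and
`e ≤ E_l := 46080·l(l−1)²(l+1)` (abc-iut-c312-7's model-free ramification bound at the place `x₀ | 7`, `GenuineK.exists_place_lamSeven`) the cell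
forces `l·7ᵃ ≤ (l·(1+a) − (l⋆²−1)·k)·e`, impossible for `a ≤ 9` (negative factor once `(l⋆²−1)·k ≥ 10·l`) and for `a = 10 + t` by the
numeric facts `E₁₃·(3 + 13t) < 13·7¹⁰·(1 + 6t) ≤ 13·7^{10+t}` (`l = 13`, `k ≥ 4`) and `E₁₁·(1 + 11t) < 11·7¹⁰·(1 + 6t)` (`l = 11`, `k ≥ 5`),
Bernoulli `1 + 6t ≤ 7ᵗ`. LIMIT OF THE METHOD (numbers): `k = 3` at `l = 13` and `k = 4` at `l = 11` are NOT reachable by any shell-radius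
reading (`35·3/13 ≈ 8.08`, `24·4/11 ≈ 8.73` lie below `sup_{e ≤ E_l} κ⁺♯(e) ≈ 10.77 / 10.54`); the table's remaining rows `2 ≤ k ≤ 3` resp. `≤ 4`
are killed only under R-W's flagged local-model input A1 (`RHSharpUpperEdgeKill.not_hStar_A1`), and `k = 1` holds on 6/16 local types (k1 number).

RESULTS (namespace `Summit.ABC.IUTFork.Repair.RHSharpUpperEdge`, continued): `one_add_six_mul_le_seven_pow`; integer kills
`not_sharpCell_topLabel_thirteen_sharp` (`e ≤ 1207664640`, `k ≥ 4`, `P·13 = k·e ⟹ ¬ SharpCell 7 e P 36`) and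
`not_sharpCell_topLabel_eleven_sharp` (`e ≤ 608256000`, `k ≥ 5`, `P·11 = k·e ⟹ ¬ SharpCell 7 e P 25`); the packaged genuine plumbing
**`exists_topCell_of_hStar`** (`H⋆₁₀ ⟹ ∃ e P, 1 ≤ e ≤ E_l ∧ P·l = k·e ∧ SharpCell 7 e P l⋆²`, at abc-iut-c312-7's place); and the model-free rows
**`not_hStar_lamSeven_l13_sharp`** (`k ≥ 4`) and **`not_hStar_lamSeven_l11_sharp`** (`k ≥ 5`).
§3: kernel witnesses of the limit of §1–§2. §4 (**the row's strongest kill**): abc-iut-W-neg-1's landed local type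
`GenuineK.absRamificationIdx_kOf_le_thirty_mul_lamSeven` (`e(K_{x₀}/ℚ_7) ≤ 30·l` at every `x₀ | 7`, cyclic tame inertia) turns the A1-conditional
`RHSharpUpperEdgeKill.not_hStar_A1` into the MODEL-FREE **`not_hStar_lamSeven_thirty`** (`11 ≤ l ≤ 68`, `16·l ≤ k·(l−3)(l+1)`) and its rows
**`not_hStar_lamSeven_l11_two`**, **`not_hStar_lamSeven_l13_two`**: `¬ H⋆₁₀` at EVERY genuine `λ_k` datum with `k ≥ 2`, `l ∈ {11, 13}` — all
240 rows `k ≥ 2` of the lamSeven block of `I06STAR-COLUMNS` by one named theorem; the 16 rows `k = 1` stay decided by number (6 hold, 10 fail).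
[cite: Mochizuki2012, IUTchI Def. 3.1 (b),(c) pp. 61–62, Ex. 3.2 (iv) p. 71; IUTchIV Prop. 1.2 (i) p. 10, Cor. 2.2 (ii) proof (P5) p. 46]
[cite: MochizukiAbsTopIII2015, Def 5.4 (iii) p. 126] [cite: NeukirchANT1999, Ch. II (5.5)] [cite: DupuyHilado2025, §3.4]
[cite: SerreLocalFields1979, Ch. IV §2 Cor. 1 of Prop. 7] [claim: Mochizuki2012, status: disputed] for every IUT sentence quoted. Axioms: standard.
-/

noncomputable section

open Set Metric Function NumberField IsDedekindDomain
open scoped Pointwise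

namespace Summit.ABC.IUTFork.Repair.RHSharpUpperEdge

open Literature.AnabelianGeometry.AbsoluteAnabelian Literature.IUT.LogThetaLattice Literature.IUT.LogVolume
  Literature.IUT.LogVolume.RamificationCriterion Literature.IUT.HodgeTheaters Literature.NumberTheory.NumberFields
  Literature.NumberTheory.GaloisRepresentations.Ultrametric Literature.NumberTheory.DiophantineGeometry.GenEll
  Literature.NumberTheory.DiophantineGeometry
open Summit.ABC.IUTFork.Thm311 Summit.ABC.IUTFork.Thm311.Real Summit.ABC.IUTFork.Cor312 Summit.ABC.IUTFork.Cor312Prov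
  Summit.ABC.IUTFork.Conditional Summit.ABC.IUTFork.Repair.CandInternal2RealLabels Summit.ABC.IUTFork.Repair.CandInternal2RealSharp
  Summit.ABC.IUTFork.Repair.CandInternal2RealHex

/-! ## §1. Integer kills of the top-label H⋆₁₀ cell, read at every exponent `a` -/

/-- Bernoulli at `7`: `1 + 6t ≤ 7ᵗ`. -/
theorem one_add_six_mul_le_seven_pow (t : ℕ) : 1 + 6 * t ≤ 7 ^ t := by
  induction t with
  | zero => simp
  | succ t ih =>
    have h1 : 1 ≤ 7 ^ t := Nat.one_le_pow t 7 (by norm_num)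
    calc 1 + 6 * (t + 1) = (1 + 6 * t) + 6 := by ring
      _ ≤ 7 ^ t + 6 * 7 ^ t := by omega
      _ = 7 ^ (t + 1) := by ring

/-- **`l = 13`, SHARP CELL, integer form**: `1 ≤ e ≤ E₁₃ = 46080·13·144·14 = 1207664640`, `k ≥ 4`, `P·13 = k·e` ⟹ `¬ SharpCell 7 e P 36`
(`36 = l⋆²`, `l⋆ = 6`). [claim: Mochizuki2012, status: disputed] -/
theorem not_sharpCell_topLabel_thirteen_sharp {e P k : ℕ} (he1 : 1 ≤ e) (heE : e ≤ 1207664640) (hk : 4 ≤ k)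
    (hPl : P * 13 = k * e) : ¬ SharpCell 7 e P 36 := by
  rintro ⟨a, ha⟩
  have hc : ((if (7 : ℕ) = 2 then 2 else 1 : ℕ) : ℤ) = 1 := by norm_num
  rw [hc] at ha
  push_cast at ha
  have hPl' : (P : ℤ) * 13 = k * e := by exact_mod_cast hPl
  have hk' : (4 : ℤ) ≤ k := by exact_mod_cast hk
  have he0 : (0 : ℤ) < e := by exact_mod_cast he1
  -- `13·7ᵃ ≤ (13a − 127)·e`
  have key : 13 * (7 : ℤ) ^ a ≤ (13 * (a : ℤ) - 127) * e := by nlinarith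
  have h7pos : (0 : ℤ) < 13 * 7 ^ a := by positivity
  rcases Nat.lt_or_ge a 10 with hlt | hge
  · have ha9 : (a : ℤ) ≤ 9 := by exact_mod_cast (show a ≤ 9 by omega)
    nlinarith
  · obtain ⟨t, rfl⟩ := Nat.exists_eq_add_of_le hge
    have hB : ((1 + 6 * t : ℕ) : ℤ) ≤ ((7 ^ t : ℕ) : ℤ) := by exact_mod_cast one_add_six_mul_le_seven_pow t
    push_cast at hB key
    have heE' : (e : ℤ) ≤ 1207664640 := by exact_mod_cast heE
    have ht0 : (0 : ℤ) ≤ t := by exact_mod_cast (Nat.zero_le t)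
    have h1 : (13 * (10 + (t : ℤ)) - 127) * e ≤ (3 + 13 * t) * 1207664640 := by nlinarith
    have h2 : ((3 : ℤ) + 13 * t) * 1207664640 < 13 * 7 ^ 10 * (1 + 6 * t) := by
      norm_num
      linarith
    have h3 : (13 : ℤ) * 7 ^ 10 * (1 + 6 * t) ≤ 13 * 7 ^ (10 + t) := by
      rw [pow_add]
      have h710 : (0 : ℤ) ≤ 13 * 7 ^ 10 := by positivity
      nlinarith
    linarith

/-- **`l = 11`, SHARP CELL, integer form**: `1 ≤ e ≤ E₁₁ = 46080·11·100·12 = 608256000`, `k ≥ 5`, `P·11 = k·e` ⟹ `¬ SharpCell 7 e P 25`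
(`25 = l⋆²`, `l⋆ = 5`). [claim: Mochizuki2012, status: disputed] -/
theorem not_sharpCell_topLabel_eleven_sharp {e P k : ℕ} (he1 : 1 ≤ e) (heE : e ≤ 608256000) (hk : 5 ≤ k)
    (hPl : P * 11 = k * e) : ¬ SharpCell 7 e P 25 := by
  rintro ⟨a, ha⟩
  have hc : ((if (7 : ℕ) = 2 then 2 else 1 : ℕ) : ℤ) = 1 := by norm_num
  rw [hc] at ha
  push_cast at ha
  have hPl' : (P : ℤ) * 11 = k * e := by exact_mod_cast hPl
  have hk' : (5 : ℤ) ≤ k := by exact_mod_cast hk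
  have he0 : (0 : ℤ) < e := by exact_mod_cast he1
  -- `11·7ᵃ ≤ (11a − 109)·e`
  have key : 11 * (7 : ℤ) ^ a ≤ (11 * (a : ℤ) - 109) * e := by nlinarith
  have h7pos : (0 : ℤ) < 11 * 7 ^ a := by positivity
  rcases Nat.lt_or_ge a 10 with hlt | hge
  · have ha9 : (a : ℤ) ≤ 9 := by exact_mod_cast (show a ≤ 9 by omega)
    nlinarith
  · obtain ⟨t, rfl⟩ := Nat.exists_eq_add_of_le hge
    have hB : ((1 + 6 * t : ℕ) : ℤ) ≤ ((7 ^ t : ℕ) : ℤ) := by exact_mod_cast one_add_six_mul_le_seven_pow t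
    push_cast at hB key
    have heE' : (e : ℤ) ≤ 608256000 := by exact_mod_cast heE
    have ht0 : (0 : ℤ) ≤ t := by exact_mod_cast (Nat.zero_le t)
    have h1 : (11 * (10 + (t : ℤ)) - 109) * e ≤ (1 + 11 * t) * 608256000 := by nlinarith
    have h2 : ((1 : ℤ) + 11 * t) * 608256000 < 11 * 7 ^ 10 * (1 + 6 * t) := by
      norm_num
      linarith
    have h3 : (11 : ℤ) * 7 ^ 10 * (1 + 6 * t) ≤ 11 * 7 ^ (10 + t) := by
      rw [pow_add]
      have h710 : (0 : ℤ) ≤ 11 * 7 ^ 10 := by positivity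
      nlinarith
    linarith

/-! ## §2. The top-label cell at the genuine `λ_k` place, packaged; the sharp model-free rows -/

/-- **THE TOP-LABEL CELL OF H⋆₁₀ AT THE GENUINE `λ_k` PLACE, with its integer data** (the plumbing of `not_hStar_lamSeven`, packaged): `k ≥ 1`,
`l` prime `≥ 11`; if `HStarSharpUpperEdge T.D` then there are `e, P ∈ ℕ` with `1 ≤ e ≤ 46080·l(l−1)²(l+1)`, `P·l = k·e` and `SharpCell 7 e P (l⋆²)`
— namely `e = e(K_{x₀}/ℚ_7)`, `P = P_{x₀}` at abc-iut-c312-7's place `x₀ | 7` (`GenuineK.exists_place_lamSeven`; `P ∈ ℕ` by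
`Cor312Prov.exists_nat_qPilot_pilotDataOfK`; `P·l = k·e` by `norm_qIdele_eq_rpow_of_realises` on the chosen realising q-idele).
[cite: Mochizuki2012, IUTchI Def. 3.1 (b),(c) pp. 61–62, Ex. 3.2 (iv) p. 71] [cite: DupuyHilado2025, §3.4] [claim: Mochizuki2012, status: disputed] -/
theorem exists_topCell_of_hStar {k l : ℕ} (hk : 1 ≤ k) (hl : l.Prime) (h11 : 11 ≤ l)
    (T : Cor22.ThetaVolumeDatumAt (ratPoint ((2 : ℚ)⁻¹ + 2 / 7 ^ k)) l) :
    letI := T.instFieldF; letI := T.instNumberFieldF; letI := T.instAlgebraF; letI := T.instFieldK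
    letI := T.instNumberFieldK; letI := T.instAlgebraK; letI := T.instFieldFbar; letI := T.instAlgebraFbar
    letI := T.instAlgebraKFbar; letI := T.instIsElliptic
    HStarSharpUpperEdge T.D →
      ∃ e P : ℕ, 1 ≤ e ∧ e ≤ 46080 * (l * (l - 1) ^ 2 * (l + 1)) ∧ P * l = k * e ∧ SharpCell 7 e P (((l - 1) / 2) ^ 2) := by
  letI := T.instFieldF; letI := T.instNumberFieldF; letI := T.instAlgebraF; letI := T.instFieldK
  letI := T.instNumberFieldK; letI := T.instAlgebraK; letI := T.instFieldFbar; letI := T.instAlgebraFbar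
  letI := T.instAlgebraKFbar; letI := T.instIsElliptic
  haveI h7 : Fact (Nat.Prime 7) := ⟨by norm_num⟩
  intro hH
  obtain ⟨x₀, hS, -, hbound, -, hnorm⟩ := GenuineK.exists_place_lamSeven hk hl h11 T
  have hspec := (exists_realising_qIdeles_pilotDataOfK T.D).choose_spec
  obtain ⟨P, hP, -, -⟩ := exists_nat_qPilot_pilotDataOfK T.D hS
  have hls : (pilotDataOfK T.D T.K).lstar = (l - 1) / 2 := by
    unfold PilotData.lstar
    rw [pilotDataOfK_l]
  let i : Fin (pilotDataOfK T.D T.K).lstar := ⟨(l - 1) / 2 - 1, by rw [hls]; omega⟩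
  have hi : (i : ℕ) + 1 = (l - 1) / 2 := by
    show (l - 1) / 2 - 1 + 1 = (l - 1) / 2
    omega
  have hcell := hH ⟨7, by norm_num⟩ i x₀ hS P hP
  rw [hi] at hcell
  have heK : absRamificationIdx 7 (kOf (pilotDataOfK T.D T.K) 7 x₀) =
      (placeOf (pilotDataOfK T.D T.K) 7 x₀).asIdeal.ramificationIdx ℤ :=
    absRamificationIdx_rescaledCompletion T.K 7 (placeOf (pilotDataOfK T.D T.K) 7 x₀)
      (natCast_mem_placeOf (pilotDataOfK T.D T.K) 7 x₀)
  have hramF : (ramIdx T.K (placeOf (pilotDataOfK T.D T.K) 7 x₀) : ℝ) =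
      (absRamificationIdx 7 (kOf (pilotDataOfK T.D T.K) 7 x₀) : ℝ) := by
    rw [ramIdx_eq T.K (placeOf (pilotDataOfK T.D T.K) 7 x₀), heK]
  have he1 : 1 ≤ absRamificationIdx 7 (kOf (pilotDataOfK T.D T.K) 7 x₀) := absRamificationIdx_pos _ _
  have hnq := norm_qIdele_eq_rpow_of_realises (pilotDataOfK T.D T.K) _ hspec.1 hspec.2.2 ⟨7, by norm_num⟩ x₀
  have hexp : -((k : ℝ) / l) =
      -((pilotDataOfK T.D T.K).qPilot (placeOf (pilotDataOfK T.D T.K) 7 x₀)) /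
        (ramIdx T.K (placeOf (pilotDataOfK T.D T.K) 7 x₀) : ℝ) := by
    have h70 : (0 : ℝ) < 7 := by norm_num
    have hlog7 : Real.log 7 ≠ 0 := (Real.log_pos (by norm_num : (1 : ℝ) < 7)).ne'
    have hboth : (7 : ℝ) ^ (-((k : ℝ) / l)) =
        ((7 : ℕ) : ℝ) ^ (-((pilotDataOfK T.D T.K).qPilot (placeOf (pilotDataOfK T.D T.K) 7 x₀)) /
          (ramIdx T.K (placeOf (pilotDataOfK T.D T.K) 7 x₀) : ℝ)) := by
      rw [← hnorm]; exact hnq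
    have hlog := congrArg Real.log hboth
    rw [Nat.cast_ofNat, Real.log_rpow h70, Real.log_rpow h70] at hlog
    exact mul_right_cancel₀ hlog7 hlog
  rw [hP, hramF] at hexp
  have hl0 : (l : ℝ) ≠ 0 := by exact_mod_cast hl.ne_zero
  have hPlR : (P : ℝ) * l = k * (absRamificationIdx 7 (kOf (pilotDataOfK T.D T.K) 7 x₀) : ℝ) := by
    field_simp at hexp
    linarith
  have hPl : P * l = k * absRamificationIdx 7 (kOf (pilotDataOfK T.D T.K) 7 x₀) := by exact_mod_cast hPlR
  rw [← heK] at hcell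
  exact ⟨_, P, he1, hbound, hPl, hcell⟩

/-- **`l = 13`, model-free, SHARP: `¬ H⋆₁₀` at every `λ_k` datum with `k ≥ 4`** (one `k` below the print-edge threshold `k ≥ 5` of
`not_hStar_lamSeven_l13`). [claim: Mochizuki2012, status: disputed] -/
theorem not_hStar_lamSeven_l13_sharp {k : ℕ} (hk : 4 ≤ k) (T : Cor22.ThetaVolumeDatumAt (ratPoint ((2 : ℚ)⁻¹ + 2 / 7 ^ k)) 13) :
    letI := T.instFieldF; letI := T.instNumberFieldF; letI := T.instAlgebraF; letI := T.instFieldK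
    letI := T.instNumberFieldK; letI := T.instAlgebraK; letI := T.instFieldFbar; letI := T.instAlgebraFbar
    letI := T.instAlgebraKFbar; letI := T.instIsElliptic
    ¬ HStarSharpUpperEdge T.D := by
  intro hH
  obtain ⟨e, P, he1, heE, hPl, hcell⟩ := exists_topCell_of_hStar (by omega) (by norm_num) (by norm_num) T hH
  exact not_sharpCell_topLabel_thirteen_sharp he1 (by norm_num at heE; exact heE) hk hPl hcell

/-- **`l = 11`, model-free, SHARP: `¬ H⋆₁₀` at every `λ_k` datum with `k ≥ 5`** (one `k` below the print-edge threshold `k ≥ 6` of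
`not_hStar_lamSeven_l11`). [claim: Mochizuki2012, status: disputed] -/
theorem not_hStar_lamSeven_l11_sharp {k : ℕ} (hk : 5 ≤ k) (T : Cor22.ThetaVolumeDatumAt (ratPoint ((2 : ℚ)⁻¹ + 2 / 7 ^ k)) 11) :
    letI := T.instFieldF; letI := T.instNumberFieldF; letI := T.instAlgebraF; letI := T.instFieldK
    letI := T.instNumberFieldK; letI := T.instAlgebraK; letI := T.instFieldFbar; letI := T.instAlgebraFbar
    letI := T.instAlgebraKFbar; letI := T.instIsElliptic
    ¬ HStarSharpUpperEdge T.D := by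
  intro hH
  obtain ⟨e, P, he1, heE, hPl, hcell⟩ := exists_topCell_of_hStar (by omega) (by norm_num) le_rfl T hH
  exact not_sharpCell_topLabel_eleven_sharp he1 (by norm_num at heE; exact heE) hk hPl hcell

/-! ## §3. The method's limit, by kernel witnesses (integer cells only; no claim that such `e` occurs at a genuine datum) -/

/-- **`l = 13`, `k = 3` is OUT OF REACH of every shell-radius reading**: the integer cell `SharpCell 7 e P 36` HOLDS at
`e = 96636280 ≤ E₁₃`, `P = 22300680` (`P·13 = 3·e`), witness `a = 10` (`35·P + 7¹⁰ = 1062999049 ≤ 11·e = 1062999080`). So no theorem of the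
shape «`e ≤ E₁₃ ∧ P·13 = 3·e ⟹ ¬ SharpCell`» exists; the table's `k = 3` rows at `l = 13` are killed only under A1 (`RHSharpUpperEdgeKill.not_hStar_A1`). -/
example : SharpCell 7 96636280 22300680 36 ∧ 22300680 * 13 = 3 * 96636280 ∧ 96636280 ≤ 1207664640 :=
  ⟨⟨10, by norm_num⟩, by norm_num, by norm_num⟩

/-- **`l = 11`, `k = 4` is OUT OF REACH likewise**: `SharpCell 7 e P 25` HOLDS at `e = 124289110 ≤ E₁₁`, `P = 45196040` (`P·11 = 4·e`),
witness `a = 10` (`24·P + 7¹⁰ = 1367180209 ≤ 11·e = 1367180210`). -/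
example : SharpCell 7 124289110 45196040 25 ∧ 45196040 * 11 = 4 * 124289110 ∧ 124289110 ≤ 608256000 :=
  ⟨⟨10, by norm_num⟩, by norm_num, by norm_num⟩

/-! ## §4. MODEL-FREE `k ≥ 2`: the A1 bound `e(K_{x₀}/ℚ_7) ≤ 30·l` is a THEOREM at `λ_k` (abc-iut-W-neg-1, cyclic tame inertia) -/

/-- **THEOREM-GRADE KILL OF H⋆₁₀ ON THE HEX FAMILY, MODEL-FREE FROM `k ≥ 2`.** abc-iut-W-neg-1's
`Conditional.GenuineK.absRamificationIdx_kOf_le_thirty_mul_lamSeven` (`Cor312GenuineKLocalTypeThirty`: tame inertia is cyclic, so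
`e(K_{x₀}/ℚ_7) ∣ 30·l` at EVERY `x₀ | 7` of a genuine Θ-volume datum at `(ratPoint λ_k, l)`, `k ≥ 1`, `l ≥ 11`) discharges the place hypothesis
of `RHSharpUpperEdgeKill.not_hStar_A1` at abc-iut-c312-7's place (`GenuineK.exists_place_lamSeven`, `‖t_q(x₀)‖ = 7^{−k/l}`): for `l` prime,
`11 ≤ l ≤ 68` and `16·l ≤ k·(l−3)(l+1)`, **`¬ HStarSharpUpperEdge T.D` for EVERY genuine `T`** — no local-model input left.
[cite: Mochizuki2012, IUTchI Def. 3.1 (b),(c) pp. 61–62, Ex. 3.2 (iv) p. 71; IUTchIV Cor. 2.2 (ii) proof (P5) p. 46]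
[cite: SerreLocalFields1979, Ch. IV §2 Cor. 1 of Prop. 7] [claim: Mochizuki2012, status: disputed] -/
theorem not_hStar_lamSeven_thirty {k l : ℕ} (hl : l.Prime) (h11 : 11 ≤ l) (hl68 : l ≤ 68)
    (hkl : 16 * l ≤ k * ((l - 3) * (l + 1))) (T : Cor22.ThetaVolumeDatumAt (ratPoint ((2 : ℚ)⁻¹ + 2 / 7 ^ k)) l) :
    letI := T.instFieldF; letI := T.instNumberFieldF; letI := T.instAlgebraF; letI := T.instFieldK
    letI := T.instNumberFieldK; letI := T.instAlgebraK; letI := T.instFieldFbar; letI := T.instAlgebraFbar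
    letI := T.instAlgebraKFbar; letI := T.instIsElliptic
    ¬ HStarSharpUpperEdge T.D := by
  letI := T.instFieldF; letI := T.instNumberFieldF; letI := T.instAlgebraF; letI := T.instFieldK
  letI := T.instNumberFieldK; letI := T.instAlgebraK; letI := T.instFieldFbar; letI := T.instAlgebraFbar
  letI := T.instAlgebraKFbar; letI := T.instIsElliptic
  haveI h7 : Fact (Nat.Prime 7) := ⟨by norm_num⟩
  have hk : 1 ≤ k := by
    rcases Nat.eq_zero_or_pos k with h0 | hpos
    · subst h0
      omega
    · exact hpos
  obtain ⟨x₀, -, -, -, -, hnorm⟩ := GenuineK.exists_place_lamSeven hk hl h11 T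
  have he := GenuineK.absRamificationIdx_kOf_le_thirty_mul_lamSeven hk h11 T x₀
  exact not_hStar_A1 hk hl (by omega) hl68 hkl T x₀ hnorm he

/-- **`l = 11`: `¬ H⋆₁₀` at EVERY `λ_k` datum with `k ≥ 2`, model-free** (`16·11 = 176 ≤ 96·k`). On the table of record
(`I06STAR-COLUMNS` lamSeven block) these are all 120 rows `k ≥ 2` at `l = 11`; the `k = 1` rows are decided by number only (local-type dependent).
[claim: Mochizuki2012, status: disputed] -/
theorem not_hStar_lamSeven_l11_two {k : ℕ} (hk : 2 ≤ k) (T : Cor22.ThetaVolumeDatumAt (ratPoint ((2 : ℚ)⁻¹ + 2 / 7 ^ k)) 11) :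
    letI := T.instFieldF; letI := T.instNumberFieldF; letI := T.instAlgebraF; letI := T.instFieldK
    letI := T.instNumberFieldK; letI := T.instAlgebraK; letI := T.instFieldFbar; letI := T.instAlgebraFbar
    letI := T.instAlgebraKFbar; letI := T.instIsElliptic
    ¬ HStarSharpUpperEdge T.D :=
  not_hStar_lamSeven_thirty (by norm_num) le_rfl (by norm_num) (by show 16 * 11 ≤ k * 96; omega) T

/-- **`l = 13`: `¬ H⋆₁₀` at EVERY `λ_k` datum with `k ≥ 2`, model-free** (`16·13 = 208 ≤ 140·k`). [claim: Mochizuki2012, status: disputed] -/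
theorem not_hStar_lamSeven_l13_two {k : ℕ} (hk : 2 ≤ k) (T : Cor22.ThetaVolumeDatumAt (ratPoint ((2 : ℚ)⁻¹ + 2 / 7 ^ k)) 13) :
    letI := T.instFieldF; letI := T.instNumberFieldF; letI := T.instAlgebraF; letI := T.instFieldK
    letI := T.instNumberFieldK; letI := T.instAlgebraK; letI := T.instFieldFbar; letI := T.instAlgebraFbar
    letI := T.instAlgebraKFbar; letI := T.instIsElliptic
    ¬ HStarSharpUpperEdge T.D :=
  not_hStar_lamSeven_thirty (by norm_num) (by norm_num) (by norm_num) (by show 16 * 13 ≤ k * 140; omega) T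

end Summit.ABC.IUTFork.Repair.RHSharpUpperEdge

end
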